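import Literature.NumberTheory.EllipticCurves.Skinner2016.HidaCongruentMembers
import Literature.NumberTheory.EllipticCurves.SelmerPInftyRestriction
import Summits.BirchSwinnertonDyer.BirchSwinnertonDyer.Theorems.ErratumRoadFiveBigRepArithInputs
import Summits.BirchSwinnertonDyer.Rank1Residual.X11b.TorsionCohomologyControl
import HarnessLib

/-!
# K2 crux 20169 `IMCDivAtErratumDataAllR` (H3♭, re-oriented), ROAD FF v4 — stub 2, binder `e m`:
# the Hida congruence (b) OVER `Γ_K` ON THE `K̄`-POINTS (input `hb` of `RoadFFMember.nonempty_memberCongruence`)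

Cell `bsd-stepL`, seat `bsd-stepL-imc-p1` (g9). `--supports stmt-BirchSwinnertonDyer-20169 --as helper`.
HONEST FRAMING: bookkeeping only; closes no item; no definition, no named fact, no `sorry`; BSD is proved
for no pair; no census number moves (T7).

## What this file proves

F2 (`Skinner2016.HidaCongruentMember.exists_equivariant_equiv_restrict`, defn-ty1 p496942) hands the
congruence (b) as an `𝒪_m[Γ_K]`-isomorphism `A_{g_m}[p^m] ≃ (E[p^∞] ⊗_{ℤ_p} 𝒪_m)[p^m]` whose `E`-side is
`curveCoeffRep W ι = ρ_{E,p} ⊗ 1` on `𝒪_m ⊗ E(ℚ̄)[p^∞]`, RESTRICTED along `absGaloisRestrict ℚ K`. The kernel's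
member-congruence assembly (`RoadFFMember.nonempty_memberCongruence`, p502247) and its `hF1` input
(`RoadFFMember.nonempty_XAc_equiv_XBig`, p502674) live on the `K̄`-points: `ρ = (W.baseChange K).primary
TorsionGaloisRep p` on `E_K(K̄)[p^∞]`. This file transports (b) from the one to the other:

* §1 `PrimaryTorsion.smul_eq_appr_nsmul`, `PrimaryTorsion.map_smul_of_addMonoidHom`,
  `PrimaryTorsion.exists_linearEquiv_of_addEquiv` — additive maps between `p`-primary torsion modules are
  `ℤ_p`-linear (the `ℤ_p`-action is through `ℤ/p^k` on an element killed by `p^k`, Mathlib `PadicInt.appr`).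
* §2 `exists_primaryTorsion_baseChange_equiv` — a `ℤ_p`-linear `E(ℚ̄)[p^∞] ≃ E_K(K̄)[p^∞]` equivariant for
  `absGaloisRestrict ℚ K : Γ_K → Γ_ℚ` (the tree's `primaryBaseChangeEquiv` + `primaryBaseChangeMap_smul`
  along `resGal`, and `resGal = absGaloisRestrict`, imc-p1 g8's `resGalOfEmb_absClosureEmbedding_eq`).
* §3 `exists_coeffExtension_congr` — an equivariant `R`-linear `θ : A ≃ B` induces an equivariant
  `𝒪`-linear `𝒪 ⊗_R A ≃ 𝒪 ⊗_R B` for `ρ ⊗ 1` (Mathlib `LinearEquiv.baseChange`);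
  `ContinuousRep.extendScalars_restrict_apply` (`(ρ|_H) ⊗ 1 = (ρ ⊗ 1)|_H`);
  `exists_torsionBy_congr` — a linear isomorphism restricts to the `r`-torsion submodules.
* §4 **`exists_torsionCongruence_baseChange`** — for a Hida member `D : HidaCongruentMember W p m` and a
  number field `K`: an `𝒪_m`-linear `A_{g_m}[p^m] ≃ (𝒪_m ⊗ E_K(K̄)[p^∞])[p^m]`, `Γ_K`-equivariant for
  `D.Δ.cofreeRepOver K` and `((W.baseChange K).primaryTorsionGaloisRep p).extendScalars 𝒪_m` — VERBATIM the
  hypothesis `hb` of `RoadFFMember.nonempty_memberCongruence` / `nonempty_quotPow_XBig_equiv_of_torsionCongruence`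
  (with `TorsionControl.torsionRep`), at `ρ𝒪 := ((W.baseChange K).primaryTorsionGaloisRep p).extendScalars 𝒪_m`,
  `ρg := D.Δ.cofreeRepOver K`.

References: [Skinner2016PacificMC] §2.6 (2-6-1), §3.1 (b) (p. 192); [Castella2018Erratum] proof of Thm. 1.1 (b),
Lemma 2.1 (pp. 2, 4: the argument runs over `G_K`); [SerreGaloisCohomology1997] II.§1.1 (restriction
`Γ_K → Γ_ℚ`, independence of the algebraic closure); [Lang1990] Ch. 5 §1 (`ℤ_p`-modules of `p`-power torsion).
-/

set_option autoImplicit false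

noncomputable section

open scoped TensorProduct

open Field NumberField
open Literature.NumberTheory.GaloisRepresentations Literature.NumberTheory.EllipticCurves
  Literature.NumberTheory.EllipticCurves.GreenbergSelmer Literature.NumberTheory.EllipticCurves.Skinner2016
  WeierstrassCurve

universe u v w

/-! ### §3a `(ρ|_H) ⊗ 1 = (ρ ⊗ 1)|_H` pointwise -/

namespace Literature.NumberTheory.GaloisRepresentations.ContinuousRep

/-- Extension of scalars commutes with restriction to a subgroup, pointwise:
`((ρ|_φ) ⊗ 1)(h) x = (ρ ⊗ 1)(φ h) x` (both are `(ρ (φ h)) ⊗ 1`). [cite: Skinner2016PacificMC, §2.6 (2-6-1)] -/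
theorem extendScalars_restrict_apply {R : Type*} [CommRing R] [TopologicalSpace R] (𝒪 : Type v) [CommRing 𝒪]
    [Algebra R 𝒪] [TopologicalSpace 𝒪] {A : Type w} [AddCommGroup A] [Module R A] [TopologicalSpace A]
    [DiscreteTopology A] {G : Type u} [Group G] [TopologicalSpace G] [ContinuousMul G]
    {H : Type*} [Group H] [TopologicalSpace H] [ContinuousMul H]
    (ρ : ContinuousRep G R A) (φ : H →ₜ* G) (h : H) (x : CoeffExtension R 𝒪 A) :
    (ρ.restrict φ).extendScalars 𝒪 h x = ρ.extendScalars 𝒪 (φ h) x := by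
  induction x using CoeffExtension.induction_on with
  | zero => rw [map_zero, map_zero]
  | tmul c a => rw [extendScalars_apply_tmul, extendScalars_apply_tmul, restrict_apply]
  | add x y hx hy => rw [map_add, map_add, hx, hy]

end Literature.NumberTheory.GaloisRepresentations.ContinuousRep

namespace Summit.BirchSwinnertonDyer.Rank1Residual.X11b.RoadFFMember

/-! ### §1 Additive maps of `p`-primary torsion modules are `ℤ_p`-linear -/

section ZpLinear

variable {p : ℕ} [Fact p.Prime] {A : Type u} {B : Type v} [AddCommGroup A] [AddCommGroup B]

/-- `c • a = (c mod p^k) • a` (a natural multiple) for any `k` with `p^k a = 0`: `c ≡ appr c k (mod p^k)`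
(Mathlib `PadicInt.appr_spec`) and `p^k` kills `a`. [cite: Lang1990, Ch. 5 §1 (the action of `ℤ_p = lim ℤ/p^k`)] -/
theorem PrimaryTorsion.smul_eq_appr_nsmul (c : ℤ_[p]) (a : PrimaryTorsion A p) {k : ℕ}
    (hk : p ^ k • (a : A) = 0) : c • a = c.appr k • a := by
  obtain ⟨d, hd⟩ := Ideal.mem_span_singleton'.mp (PadicInt.appr_spec k c)
  have hc : c = ((c.appr k : ℕ) : ℤ_[p]) + d * (p : ℤ_[p]) ^ k := by rw [hd]; ring
  conv_lhs => rw [hc]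
  rw [add_smul, mul_smul, PrimaryTorsion.pow_smul_eq_zero_of a hk, smul_zero, add_zero,
    PrimaryTorsion.natCast_smul]

/-- **An additive map `A[p^∞] → B[p^∞]` is `ℤ_p`-linear.** [cite: Lang1990, Ch. 5 §1] [cite: Serre1968, Ch. I §1.2 (the `ℤ_ℓ`-module `E_{ℓ^∞}`)] -/
theorem PrimaryTorsion.map_smul_of_addMonoidHom (f : PrimaryTorsion A p →+ PrimaryTorsion B p) (c : ℤ_[p])
    (a : PrimaryTorsion A p) : f (c • a) = c • f a := by
  have hk : p ^ a.level • (a : A) = 0 := a.level_spec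
  have hka : p ^ a.level • a = 0 :=
    PrimaryTorsion.ext (by rw [PrimaryTorsion.val_nsmul, hk, PrimaryTorsion.val_zero])
  have hkb : p ^ a.level • ((f a : PrimaryTorsion B p) : B) = 0 := by
    rw [← PrimaryTorsion.val_nsmul, ← map_nsmul, hka, map_zero, PrimaryTorsion.val_zero]
  rw [PrimaryTorsion.smul_eq_appr_nsmul c a hk, PrimaryTorsion.smul_eq_appr_nsmul c (f a) hkb, map_nsmul]

/-- An additive isomorphism `A[p^∞] ≃ B[p^∞]` is a `ℤ_p`-linear isomorphism (same map). [cite: Lang1990, Ch. 5 §1] -/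
theorem PrimaryTorsion.exists_linearEquiv_of_addEquiv (e : PrimaryTorsion A p ≃+ PrimaryTorsion B p) :
    ∃ e' : PrimaryTorsion A p ≃ₗ[ℤ_[p]] PrimaryTorsion B p, ∀ a, e' a = e a :=
  ⟨{ e with map_smul' := fun c a => PrimaryTorsion.map_smul_of_addMonoidHom e.toAddMonoidHom c a },
    fun _ => rfl⟩

end ZpLinear

/-! ### §2 `E(ℚ̄)[p^∞] ≃ E_K(K̄)[p^∞]`, `ℤ_p`-linear and `Γ_K`-equivariant along `absGaloisRestrict ℚ K` -/

section Curve

variable (W : WeierstrassCurve ℚ) (p : ℕ) [Fact p.Prime] (K : Type) [Field K] [NumberField K]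

/-- The tree's restriction `resGal K : Γ_K → Γ_ℚ` for the chosen embedding (`Sha.lean`) IS
`absGaloisRestrict ℚ K` (both embeddings are `IsAlgClosed.lift`; imc-p1 g8's
`resGalOfEmb_absClosureEmbedding_eq`). [cite: SerreGaloisCohomology1997, II.§1.1] -/
theorem resGal_rat_apply (σ : absoluteGaloisGroup K) : resGal (K := ℚ) K σ = absGaloisRestrict ℚ K σ := by
  rw [resGal_eq]
  exact BigRep.resGalOfEmb_absClosureEmbedding_eq K σ

/-- **`E(ℚ̄)[p^∞] ≃ E_K(K̄)[p^∞]` as `ℤ_p[Γ_K]`-modules**, `Γ_K` acting on the left through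
`absGaloisRestrict ℚ K` (`(W.primaryTorsionGaloisRep p)|_{Γ_K}`) and on the right by
`(W.baseChange K).primaryTorsionGaloisRep p`: the tree's `primaryBaseChangeEquiv` (points along the
chosen `ℚ̄ → K̄`, bijective because `K̄` is algebraic over `ℚ`), `ℤ_p`-linear by §1, equivariant by
`primaryBaseChangeMap_smul` and `resGal = absGaloisRestrict`. [cite: SerreGaloisCohomology1997, II.§1.1] [cite: SilvermanAEC2009, VIII.§1] -/
theorem exists_primaryTorsion_baseChange_equiv :
    ∃ θ : PrimaryTorsion (geomPoints W) p ≃ₗ[ℤ_[p]] PrimaryTorsion (geomPoints (W.baseChange K)) p,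
      ∀ (σ : absoluteGaloisGroup K) (P : PrimaryTorsion (geomPoints W) p),
        θ (W.primaryTorsionGaloisRep p (absGaloisRestrict ℚ K σ) P) =
          (W.baseChange K).primaryTorsionGaloisRep p σ (θ P) := by
  obtain ⟨θ, hθ⟩ := PrimaryTorsion.exists_linearEquiv_of_addEquiv
    (A := geomPoints W) (B := geomPoints (W.baseChange K))
    (show PrimaryTorsion (geomPoints W) p ≃+ PrimaryTorsion (geomPoints (W.baseChange K)) p from
      primaryBaseChangeEquiv K W p)
  refine ⟨θ, fun σ P => ?_⟩
  rw [primaryTorsionGaloisRep_apply, primaryTorsionGaloisRep_apply, hθ, hθ]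
  have h := primaryBaseChangeMap_smul W K p σ P
  rw [resGal_rat_apply] at h
  exact h

end Curve

/-! ### §3 Coefficient extension and `r`-torsion along an equivariant isomorphism -/

section Coeff

variable {R : Type*} [CommRing R] [TopologicalSpace R] (𝒪 : Type) [CommRing 𝒪] [Algebra R 𝒪]
  [TopologicalSpace 𝒪]
  {A : Type} [AddCommGroup A] [Module R A] [TopologicalSpace A] [DiscreteTopology A]
  {B : Type} [AddCommGroup B] [Module R B] [TopologicalSpace B] [DiscreteTopology B]
  {G : Type} [Group G] [TopologicalSpace G] [ContinuousMul G]

/-- **`θ ⊗ 1`**: an `R`-linear `G`-equivariant isomorphism `θ : A ≃ B` induces an `𝒪`-linear isomorphism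
`𝒪 ⊗_R A ≃ 𝒪 ⊗_R B`, `c ⊗ a ↦ c ⊗ θ a`, equivariant for `ρ_A ⊗ 1`, `ρ_B ⊗ 1` (Mathlib
`LinearEquiv.baseChange`; equivariance checked on pure tensors). [cite: Skinner2016PacificMC, §2.6 (2-6-1) ("as `𝒪[G_ℚ]`-modules")] -/
theorem exists_coeffExtension_congr (ρA : ContinuousRep G R A) (ρB : ContinuousRep G R B) (θ : A ≃ₗ[R] B)
    (hθ : ∀ (g : G) (a : A), θ (ρA g a) = ρB g (θ a)) :
    ∃ Θ : CoeffExtension R 𝒪 A ≃ₗ[𝒪] CoeffExtension R 𝒪 B,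
      (∀ (c : 𝒪) (a : A), Θ (CoeffExtension.tmul c a) = CoeffExtension.tmul c (θ a)) ∧
      ∀ (g : G) (x : CoeffExtension R 𝒪 A), Θ (ρA.extendScalars 𝒪 g x) = ρB.extendScalars 𝒪 g (Θ x) := by
  let Θ : CoeffExtension R 𝒪 A ≃ₗ[𝒪] CoeffExtension R 𝒪 B := LinearEquiv.baseChange R 𝒪 A B θ
  have hΘ : ∀ (c : 𝒪) (a : A), Θ (CoeffExtension.tmul c a) = CoeffExtension.tmul c (θ a) := fun c a =>
    LinearEquiv.baseChange_tmul (R := R) (A := 𝒪) (M := A) (N := B) (e := θ) c a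
  refine ⟨Θ, hΘ, fun g x => ?_⟩
  induction x using CoeffExtension.induction_on with
  | zero => rw [map_zero, map_zero, map_zero]
  | tmul c a =>
    rw [ContinuousRep.extendScalars_apply_tmul, hΘ, hΘ, ContinuousRep.extendScalars_apply_tmul, hθ]
  | add x y hx hy => rw [map_add, map_add, hx, hy, map_add, map_add]

omit [TopologicalSpace 𝒪] in
/-- A linear isomorphism `Θ : M ≃ N` restricts to the `r`-torsion submodules: `M[r] ≃ N[r]`, `x ↦ Θ x`. [folklore]
[cite: Skinner2016PacificMC, §2.6 (2-6-1) (`T/p^m T`, `A[p^m]`)] -/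
theorem exists_torsionBy_congr {M N : Type} [AddCommGroup M] [Module 𝒪 M] [AddCommGroup N] [Module 𝒪 N]
    (Θ : M ≃ₗ[𝒪] N) (r : 𝒪) :
    ∃ e : Submodule.torsionBy 𝒪 M r ≃ₗ[𝒪] Submodule.torsionBy 𝒪 N r, ∀ x, (e x : N) = Θ (x : M) := by
  have hMN : ∀ x : M, x ∈ Submodule.torsionBy 𝒪 M r → Θ x ∈ Submodule.torsionBy 𝒪 N r := fun x hx => by
    rw [Submodule.mem_torsionBy_iff] at hx ⊢
    rw [← map_smul, hx, map_zero]
  have hNM : ∀ y : N, y ∈ Submodule.torsionBy 𝒪 N r → Θ.symm y ∈ Submodule.torsionBy 𝒪 M r := fun y hy => by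
    rw [Submodule.mem_torsionBy_iff] at hy ⊢
    rw [← map_smul, hy, map_zero]
  refine ⟨{ toFun := fun x => ⟨Θ x, hMN x x.2⟩,
            map_add' := fun x y => Subtype.ext (by simp),
            map_smul' := fun c x => Subtype.ext (by simp),
            invFun := fun y => ⟨Θ.symm y, hNM y y.2⟩,
            left_inv := fun x => Subtype.ext (by simp),
            right_inv := fun y => Subtype.ext (by simp) }, fun x => rfl⟩

end Coeff

/-! ### §4 (b) over `Γ_K` on the `K̄`-points — the `hb` input of `nonempty_memberCongruence` -/

section TorsionRepEq

variable {Γ : Type u} [Group Γ] [TopologicalSpace Γ] {A : Type v} [CommRing A] [TopologicalSpace A]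
  {M : Type u} [AddCommGroup M] [Module A M] [TopologicalSpace M]

/-- The kernel's `TorsionControl.torsionRep` and the Literature's `BigGaloisRep.torsionRep` are the same
subrepresentation `M[r]` (identical bodies). [cite: Castella2018Erratum, Lemma 2.1 (p. 2, "`M_g[ϖ^m] ⊂ M_g`")] -/
theorem torsionRep_eq_bigGaloisRep_torsionRep (ρ : ContinuousRep Γ A M) (r : A) :
    TorsionControl.torsionRep ρ r = BigGaloisRep.torsionRep ρ r :=
  rfl

end TorsionRepEq

section Member

variable {W : WeierstrassCurve ℚ} [W.IsGloballyMinimal] {p : ℕ} [Fact p.Prime] {m : ℕ}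

/-- **The Hida congruence (b) over `Γ_K` on the `K̄`-points.** For a Hida member `D` of `f_E` at level `m`
(F2, `Skinner2016.HidaCongruentMember`; coefficient ring `𝒪_m = padicCoeffIntegers D.ι`) and a number field `K`:
an `𝒪_m`-linear isomorphism `A_{g_m}[p^m] ≃ (𝒪_m ⊗_{ℤ_p} E_K(K̄)[p^∞])[p^m]`, `Γ_K`-equivariant for
`A_{g_m}|_{Γ_K} = D.Δ.cofreeRepOver K` and `(ρ_{E_K,p} ⊗ 1) = ((W.baseChange K).primaryTorsionGaloisRep p).extend
Scalars 𝒪_m` — F2's `exists_equivariant_equiv_restrict K` (equivariant along `absGaloisRestrict ℚ K` on the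
`ℚ̄`-points) composed with `(θ ⊗ 1)|_{[p^m]}` for the `ℤ_p[Γ_K]`-isomorphism `θ : E(ℚ̄)[p^∞] ≃ E_K(K̄)[p^∞]` of §2.
VERBATIM the hypothesis `hb` of `RoadFFMember.nonempty_quotPow_XBig_equiv_of_torsionCongruence` ∕
`nonempty_memberCongruence` at `ρ𝒪 := ((W.baseChange K).primaryTorsionGaloisRep p).extendScalars 𝒪_m`,
`ρg := D.Δ.cofreeRepOver K`. CONDITIONAL on nothing beyond the datum `D`.
[cite: Skinner2016PacificMC, §3.1 (b) (p. 192)] [cite: Castella2018Erratum, proof of Thm. 1.1, (b) and Lemma 2.1 (pp. 2, 4)] -/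
theorem exists_torsionCongruence_baseChange (D : HidaCongruentMember W p m) (K : Type) [Field K]
    [NumberField K] :
    ∃ e : Submodule.torsionBy (padicCoeffIntegers D.ι) (Cofree D.Δ.ρ (padicCoeffField D.ι))
          ((p : padicCoeffIntegers D.ι) ^ m) ≃ₗ[padicCoeffIntegers D.ι]
        Submodule.torsionBy (padicCoeffIntegers D.ι)
          (CoeffExtension ℤ_[p] (padicCoeffIntegers D.ι) (PrimaryTorsion (geomPoints (W.baseChange K)) p))
          ((p : padicCoeffIntegers D.ι) ^ m),
      ∀ (g : absoluteGaloisGroup K)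
        (a : Submodule.torsionBy (padicCoeffIntegers D.ι) (Cofree D.Δ.ρ (padicCoeffField D.ι))
          ((p : padicCoeffIntegers D.ι) ^ m)),
        (e (TorsionControl.torsionRep (D.Δ.cofreeRepOver K) ((p : padicCoeffIntegers D.ι) ^ m) g a) :
            CoeffExtension ℤ_[p] (padicCoeffIntegers D.ι) (PrimaryTorsion (geomPoints (W.baseChange K)) p)) =
          ContinuousRep.extendScalars (R := ℤ_[p]) (G := absoluteGaloisGroup K)
            (A := PrimaryTorsion (geomPoints (W.baseChange K)) p) (padicCoeffIntegers D.ι)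
            ((W.baseChange K).primaryTorsionGaloisRep p) g
            (e a : CoeffExtension ℤ_[p] (padicCoeffIntegers D.ι)
              (PrimaryTorsion (geomPoints (W.baseChange K)) p)) := by
  -- (`obtain` on these existentials sends `isDefEq` into a timeout; `Exists.elim` does not.)
  refine (exists_primaryTorsion_baseChange_equiv W p K).elim fun θ hθ => ?_
  refine (exists_coeffExtension_congr (R := ℤ_[p]) (padicCoeffIntegers D.ι)
    (A := PrimaryTorsion (geomPoints W) p) (B := PrimaryTorsion (geomPoints (W.baseChange K)) p)
    (G := absoluteGaloisGroup K)
    ((W.primaryTorsionGaloisRep p).restrict (absGaloisRestrict ℚ K)) ((W.baseChange K).primaryTorsionGaloisRep p)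
    θ (fun g P => by rw [ContinuousRep.restrict_apply]; exact hθ g P)).elim fun Θ hΘ' => ?_
  obtain ⟨-, hΘ⟩ := hΘ'
  refine (exists_torsionBy_congr (padicCoeffIntegers D.ι) Θ ((p : padicCoeffIntegers D.ι) ^ m)).elim
    fun eΘ heΘ => ?_
  refine (D.exists_equivariant_equiv_restrict K).elim fun e₀ he₀ => ?_
  -- the `E`-side actions agree: `(ρ_{E,p} ⊗ 1)|_{Γ_K} = (ρ_{E,p}|_{Γ_K}) ⊗ 1` pointwise (small goal, `ℚ̄`-side only)
  have hA : ∀ (g : absoluteGaloisGroup K) (x : CurveCoeffModule (p := p) W D.ι),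
      ((curveCoeffRep W D.ι).restrict (absGaloisRestrict ℚ K)) g x =
        ContinuousRep.extendScalars (R := ℤ_[p]) (G := absoluteGaloisGroup K)
          (A := PrimaryTorsion (geomPoints W) p) (padicCoeffIntegers D.ι)
          ((W.primaryTorsionGaloisRep p).restrict (absGaloisRestrict ℚ K)) g x := fun g x => by
    rw [ContinuousRep.restrict_apply (curveCoeffRep W D.ι) (absGaloisRestrict ℚ K) g, curveCoeffRep_def,
      ContinuousRep.extendScalars_restrict_apply]
  -- F2's equivariance, read through the kernel's `TorsionControl.torsionRep` (same body as `BigGaloisRep.torsionRep`)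
  have he₀' : ∀ (g : absoluteGaloisGroup K) (a : MemberTorsion D.Δ m),
      ((e₀ (TorsionControl.torsionRep (D.Δ.cofreeRepOver K) ((p : padicCoeffIntegers D.ι) ^ m) g a)) :
          CurveCoeffModule (p := p) W D.ι) =
        ((curveCoeffRep W D.ι).restrict (absGaloisRestrict ℚ K)) g (e₀ a : CurveCoeffModule (p := p) W D.ι) :=
    fun g a => he₀ g a
  -- `(e₀ ≫ eΘ) x = eΘ (e₀ x)` on underlying elements (explicit instances: no unification across the two sides)
  have htr : ∀ x : MemberTorsion D.Δ m,
      (((e₀.trans eΘ) x :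
          Submodule.torsionBy (padicCoeffIntegers D.ι)
            (CoeffExtension ℤ_[p] (padicCoeffIntegers D.ι) (PrimaryTorsion (geomPoints (W.baseChange K)) p))
            ((p : padicCoeffIntegers D.ι) ^ m)) :
          CoeffExtension ℤ_[p] (padicCoeffIntegers D.ι) (PrimaryTorsion (geomPoints (W.baseChange K)) p)) =
        Θ (e₀ x : CurveCoeffModule (p := p) W D.ι) := fun x =>
    (congrArg Subtype.val (LinearEquiv.trans_apply (e₁₂ := e₀) (e₂₃ := eΘ) x)).trans (heΘ (e₀ x))
  -- no `rw`/`obtain` on the full goal: matching subterms across `Cofree …` and `CoeffExtension …` is what times out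
  exact ⟨e₀.trans eΘ, fun g a =>
    (htr _).trans (((congrArg Θ (he₀' g a)).trans ((congrArg Θ (hA g _)).trans (hΘ g _))).trans
      (congrArg _ (htr a).symm))⟩

end Member

end Summit.BirchSwinnertonDyer.Rank1Residual.X11b.RoadFFMember

end
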